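import Literature.Probability.LatticeModels.ImprovedTreeDiagramBoundSum
import Literature.Probability.LatticeModels.SlidingScaleInfraredBoundProofs
import Literature.Probability.LatticeModels.SusceptibilityMeanFieldBound
import Mathlib.Analysis.Subadditive
import HarnessLib

/-!
# High-dimensional triviality of Ising scaling limits, VIII: Panis's `d = 4` bound in the sharp-length window from ADC Theorem 1.3

Topic `Literature/Probability/LatticeModels`; family `crit-ising` (crit-ising.S13). Proof
companion of `HighDimTrivialityUniform`: it REDUCES the named fact

* `panis_ursellFourSum_le_four` (`HighDimTrivialityUniform`) — R. Panis, *Triviality of the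
  scaling limits of critical Ising and `φ⁴` models with effective dimension at least four*,
  Ann. Probab. 54 (2026) = arXiv:2309.05797, Corollary 1.8 and its proof, §6.6 (p. 33), for the
  nearest-neighbour model on `ℤ⁴`: `Σ_L⁻² ∑_{x ∈ Λ_{rL}⁴} |U₄(x)| ≤ C r^γ (log L)^{-c}` for
  `0 ≤ β ≤ β_c`, `L > 1`, `r ≥ 1` in the sharp-length window, written (as in the fact) as
  "`β = β_c`, or `φ_β(S) ≥ 1/2` for every finite `S ∋ 0`, `S ⊆ Λ_{16L}`" with
  Duminil-Copin–Tassion's `φ_β = dctIsingPhi` —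

to the single named fact `aizenmanDuminilCopin_improvedTreeDiagramBound` (M. Aizenman,
H. Duminil-Copin, Ann. of Math. 194 (2021) = arXiv:1912.07973, **Theorem 1.3**, the improved tree
diagram bound in the correlation-length window `L ≤ ξ(β)`), every other input being a theorem of
the tree: `panis_ursellFourSum_le_four_of_improvedTreeDiagramBound`. Once Theorem 1.3 is
discharged, `panis_ursellFourSum_le_four_holds` is the one-liner
`panis_ursellFourSum_le_four_of_improvedTreeDiagramBound aizenmanDuminilCopin_improvedTreeDiagramBound_holds`.
(ADC Lemma 6.3 in the correlation-length window is already the theorem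
`aizenmanDuminilCopin_bubbleDiagram_growth_holds` of `BubbleDiagramGrowthDischarge`; here its
sharp-length-window analogue, Panis's Lemma 6.16, is what is needed and proved.)
**No definition and no named fact is introduced.**

## The argument

Panis, §6.6 (p. 33): "Applying the improved tree diagram bound we obtain
`S(β,L,f) ≤ C ∑ … /(B_{L(x₁,…,x₄)}(β)^c Σ_L(β)²)` … the conclusion builds on the same tools as
§5 and Lemma 6.16 (bubble growth); we refer to [ADC] for the details", i.e. to ADC §6.3
(pp. 26–27), which the tree proves as `aizenmanDuminilCopin_ursellFourSum_le_of_facts`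
(`ImprovedTreeDiagramBoundSum`) in the ADC window `L ≤ ξ(β)`. That computation applies the
improved tree diagram bound only at the scale `ℓ = L^{1/4}` and uses the window at scale `L`
only through (a) the bubble growth `B_L ≤ (1 + C log(L/ℓ)/log ℓ) B_ℓ` (ADC Lemma 6.3 = Panis
Lemma 6.16), itself proved in the tree from the sliding-scale infrared bound (ADC Thm 5.6, a
THEOREM of the tree) and the lower bound `∑_{y ∈ ∂Λ_n} ⟨σ₀σ_y⟩ ≥ θ`, `n ≤ L`, on sphere sums
(`bubbleDiagram_growth_abstract`), and (b) `β` bounded below. For the nearest-neighbour model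
the sharp-length window supplies both and more:

1. *Sphere sums* (`dctIsingPhi_box_le_sphereSum`, `sphereSum_ge_of_dctIsingPhi`): only boundary
   sites of `Λ_n` have neighbours outside, at most `2d` each, and
   `⟨σ₀σ_x⟩^∅_{Λ_n} ≤ ⟨σ₀σ_x⟩^∅ ≤ ⟨σ₀σ_x⟩⁺` (volume monotonicity, Griffiths), `tanh β ≤ 1`, so
   `φ_β(Λ_n) ≤ 2d ∑_{∂Λ_n} ⟨σ₀σ_y⟩⁺`; the window (`φ_β(Λ_n) ≥ 1/2` for `n ≤ 16L`) gives
   `∑_{∂Λ_n} ⟨σ₀σ_y⟩⁺ ≥ 1/16`. At `β = β_c` the window property holds for every `S ∋ 0`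
   (`one_le_dctIsingPhi_of_criticalBeta_le`, Duminil-Copin–Tassion's `β̃_c = β_c`), which is
   Panis's Remark 3.22 (`L(β_c) = ∞`).
2. *Bubble growth in the sharp-length window* (`bubbleDiagram_growth_of_sphereSum`, Panis
   Lemma 6.16 for the nearest-neighbour model): `bubbleDiagram_growth_abstract` with the proved
   sliding-scale bound.
3. *The correlation length below the sharp length* (`twoPointPlus_axis_le_exp_neg`, Fekete's
   lemma on the supermultiplicative axis two-point function, Friedli–Velenik 2017, §3.10.7:
   `⟨σ₀σ_{ne₁}⟩⁺ ≤ e^{-n/ξ(β)}` for every `n`, `ξ⁻¹ = invCorrLength`; with the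
   Messager–Miracle-Solé comparison `⟨σ₀σ_y⟩⁺ ≤ ⟨σ₀σ_{‖y‖_∞ e₁}⟩⁺`): the sphere-sum bound at
   `n = ⌊16L⌋` gives `1/16 ≤ 216 n³ e^{-n/ξ}`, i.e. `n/ξ ≤ log(3456 n³)`
   (`mul_invCorrLength_le_log_of_sphereSum`), whence `L^{1/4} ξ(β)⁻¹ ≤ 1` for `L ≥ e³²`: the ADC
   window holds at the scale `ℓ = L^{1/4}` where Theorem 1.3 is applied. (The sharp length may
   exceed `ξ(β)` by a logarithm — `φ_β(Λ_k) ≳ k e^{-k/ξ}` — which is why the reduction goes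
   through the scale `ℓ` and not through a comparison `L(β) ≲ ξ(β)`.)
4. *Assembly* (`panis_ursellFourSum_le_four_of_improvedTreeDiagramBound`): the three regimes of
   `aizenmanDuminilCopin_ursellFourSum_le_of_facts` verbatim — `L ≤ e³²` (plain tree diagram bound
   and infrared bound), `β ≤ β₀` with `φ_{β₀}({0}) < 1/2` (high temperature,
   `ursellFourSum_le_of_le_smallBeta`), and the window regime with `ℓ = L^{1/4}`, Theorem 1.3 at
   scale `ℓ`, the split of `∑|U₄|`, `Σ_L ≥ L⁴χ_L/(256D)`, bubble growth twice and the logarithmic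
   gain `χ_L²/(L⁴B_ℓ) ≤ K/√(log L)` — with exponent `c = min(c₁,1)/2` and `γ = 12`.

## References

* R. Panis, arXiv:2309.05797, Cor. 1.8, §6.6 (p. 33), Def. 3.21, Rem. 3.22, Lemma 6.16
  [Panis2023Triviality].
* M. Aizenman, H. Duminil-Copin, Ann. of Math. 194 (2021) = arXiv:1912.07973, Thm 1.3 (p. 6),
  Lemma 6.3 (p. 21), Thm 5.6 (p. 18), §6.3 (pp. 26–27) [AizenmanDuminilCopinAnnals2021].
* H. Duminil-Copin, V. Tassion, CMP 343 (2016), §2.1 [DuminilCopinTassionCMP2016].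
* S. Friedli, Y. Velenik (2017), §3.10.7 (Fekete / correlation length) [FriedliVelenik2017].

## Mathlib

`Subadditive.tendsto_lim`, `Subadditive.lim_le_div` (Fekete's lemma), `Filter.Tendsto.liminf_eq`,
`Real.log_le_iff_le_exp`, `Real.le_log_iff_exp_le`, `Real.log_two_lt_d9`, `Real.rpow_natCast`.
-/

noncomputable section

open MeasureTheory Filter Topology Finset
open Literature.Probability.LatticeModels Literature.Probability.Percolation

namespace Literature.Probability.LatticeModels

/-! ### Part 1. Fekete: `⟨σ₀σ_{ne₁}⟩⁺ ≤ e^{-n/ξ}` -/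

section Fekete

variable {d : ℕ} [NeZero d] {β : ℝ}

/-- **The two-point function along an axis is below `e^{-n/ξ(β)}` at EVERY distance**
(Friedli–Velenik 2017, §3.10.7: by GKS II the sequence `-log ⟨σ₀σ_{ne₁}⟩⁺_β` is subadditive, so
by Fekete's lemma `ξ(β)⁻¹ = lim -log⟨σ₀σ_{ne₁}⟩⁺/n = inf_n -log⟨σ₀σ_{ne₁}⟩⁺/n`; the tree's
`invCorrLength` is the `liminf` of that sequence, which is its limit). For `β ≥ 0` with
`⟨σ₀σ_{e₁}⟩⁺_β > 0` and every `n`: `⟨σ₀σ_{ne₁}⟩⁺_β ≤ exp(-n ξ(β)⁻¹)`. [cite: FriedliVelenik2017, §3.10.7 (existence of the correlation length by subadditivity)] -/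
theorem twoPointPlus_axis_le_exp_neg (hβ : 0 ≤ β)
    (hpos : 0 < twoPointPlus d β (Pi.single 0 1)) (M : ℕ) :
    twoPointPlus d β ((M : ℤ) • Pi.single (0 : Fin d) (1 : ℤ)) ≤
      Real.exp (-((M : ℝ) * invCorrLength (twoPointPlus d β))) := by
  set e : Site d := Pi.single (0 : Fin d) (1 : ℤ) with he
  have haxis : ∀ n : ℕ, twoPointPlus d β e ^ n ≤ twoPointPlus d β ((n : ℤ) • e) :=
    fun n => by rw [he, zsmul_single_zero_one]; exact pow_le_twoPointPlus_single hβ 0 n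
  have haxis_pos : ∀ n : ℕ, 0 < twoPointPlus d β ((n : ℤ) • e) :=
    fun n => lt_of_lt_of_le (pow_pos hpos n) (haxis n)
  have haxis_le : ∀ n : ℕ, twoPointPlus d β ((n : ℤ) • e) ≤ 1 :=
    fun n => twoPointPlus_le_one_of_nonneg hβ _
  -- the subadditive sequence `u n = -log ⟨σ₀σ_{ne₁}⟩⁺`
  set u : ℕ → ℝ := fun n => -Real.log (twoPointPlus d β ((n : ℤ) • e)) with hu
  have hsub : Subadditive u := by
    intro m n
    have h := twoPointPlus_mul_le_twoPointPlus hβ ((m : ℤ) • e) (((m + n : ℕ) : ℤ) • e)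
    have hdiff : (((m + n : ℕ) : ℤ) • e) - ((m : ℤ) • e) = (n : ℤ) • e := by
      rw [show ((m + n : ℕ) : ℤ) = (m : ℤ) + (n : ℤ) by push_cast; ring, add_zsmul,
        add_sub_cancel_left]
    rw [hdiff] at h
    have hlog := Real.log_le_log (mul_pos (haxis_pos m) (haxis_pos n)) h
    rw [Real.log_mul (haxis_pos m).ne' (haxis_pos n).ne'] at hlog
    simp only [hu]
    linarith
  have hu0 : ∀ n, 0 ≤ u n := fun n => by
    simp only [hu]
    rw [neg_nonneg]
    exact Real.log_nonpos (haxis_pos n).le (haxis_le n)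
  have hbdd : BddBelow (Set.range fun n => u n / n) :=
    ⟨0, by rintro _ ⟨n, rfl⟩; exact div_nonneg (hu0 n) (Nat.cast_nonneg n)⟩
  have htend := hsub.tendsto_lim hbdd
  -- `invCorrLength` is Fekete's limit
  have hinv : invCorrLength (twoPointPlus d β) = hsub.lim := by
    unfold invCorrLength
    have heq : (fun n : ℕ => -Real.log |twoPointPlus d β ((n : ℤ) • Pi.single (0 : Fin d) (1 : ℤ))| / n) =
        fun n => u n / n := by
      funext n
      simp only [hu, ← he]
      rw [abs_of_pos (haxis_pos n)]
    rw [heq]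
    exact htend.liminf_eq
  rcases Nat.eq_zero_or_pos M with hM | hM
  · subst hM
    simp [twoPointPlus_zero]
  · have hlim := hsub.lim_le_div hbdd (n := M) (by omega)
    rw [← hinv] at hlim
    have hM' : (0 : ℝ) < M := by exact_mod_cast hM
    have h1 : (M : ℝ) * invCorrLength (twoPointPlus d β) ≤ u M := by
      rw [le_div_iff₀ hM'] at hlim
      linarith
    simp only [hu] at h1
    rw [← Real.log_le_iff_le_exp (haxis_pos M)]
    linarith

/-- **The two-point function is below `e^{-‖y‖_∞/ξ(β)}` everywhere** (`d ≥ 1`, `β ≥ 0`,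
`⟨σ₀σ_{e₁}⟩⁺ > 0`): the Messager–Miracle-Solé comparison `⟨σ₀σ_y⟩⁺ ≤ ⟨σ₀σ_{‖y‖_∞e₁}⟩⁺`
(`twoPointPlus_le_axis_of_mem_sphere`) and `twoPointPlus_axis_le_exp_neg`. [cite: FriedliVelenik2017, §3.10.7] -/
theorem twoPointPlus_le_exp_neg_supNorm (hβ : 0 ≤ β) (hd : 1 ≤ d)
    (hpos : 0 < twoPointPlus d β (Pi.single 0 1)) (y : Site d) :
    twoPointPlus d β y ≤ Real.exp (-((Site.supNorm y : ℝ) * invCorrLength (twoPointPlus d β))) := by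
  have hMMS : ∀ {β : ℝ}, messager_miracleSole (d := d) (β := β) := fun {β} =>
    messager_miracleSole_holds (d := d) (β := β)
  have h1 := twoPointPlus_le_axis_of_mem_sphere hMMS twoPointPlus_reflection_invariant_holds
    twoPointPlus_perm_invariant_holds hβ hd (self_mem_sphere y)
  have h0 : (⟨0, hd⟩ : Fin d) = 0 := Fin.ext (by simp)
  rw [h0, ← zsmul_single_zero_one] at h1
  exact h1.trans (twoPointPlus_axis_le_exp_neg hβ hpos _)

end Fekete

/-! ### Part 2. The sharp-length window: sphere sums, the window at `β_c`, the correlation length -/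

section Window

variable {d : ℕ}

/-- **`φ_β(Λ_n)` is carried by the sphere**: `φ_β(Λ_n) ≤ 2d ∑_{y ∈ ∂Λ_n} ⟨σ₀σ_y⟩⁺_β` for
`β ≥ 0`, `d ≥ 1` (only the sites of `∂Λ_n` have neighbours outside `Λ_n`, at most `2d` of them;
`tanh β ≤ 1`; `⟨σ₀σ_x⟩^∅_{Λ_n;β} ≤ ⟨σ₀σ_x⟩^∅_β ≤ ⟨σ₀σ_x⟩⁺_β` by Griffiths' monotonicity in the
volume and the plus/free comparison; the analogue for Duminil-Copin–Tassion's `φ` of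
`bdryPsi_box_le_sphereSum`). [cite: DuminilCopinTassionCMP2016, eq. (2.1)–(2.2), §2.1] [cite: FriedliVelenik2017, Exercise 3.12 and Exercise 3.25] -/
theorem dctIsingPhi_box_le_sphereSum (hd : 1 ≤ d) {β : ℝ} (hβ : 0 ≤ β) (n : ℕ) :
    dctIsingPhi d β (box d n) ≤ 2 * d * ∑ y ∈ sphere d n, twoPointPlus d β y := by
  classical
  rw [dctIsingPhi_eq_sum_card_mul]
  have hmono : isingCorr_free_mono_volume (d := d) := isingCorr_free_mono_volume_holds
  have hlim : hasBoxLimit_isingCorr_free d := hasBoxLimit_isingCorr_free_holds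
  have hgks : ∀ {Λ A : Finset (Site d)} {β h : ℝ} {bc : BoundaryCondition (Site d)},
      gks_one (zdGraph d) (Λ := Λ) (A := A) (β := β) (h := h) (bc := bc) :=
    GKSInequalities.gks_one_holds (zdGraph d)
  have htanh0 : 0 ≤ Real.tanh β := tanh_nonneg hβ
  have htanh1 : Real.tanh β ≤ 1 := (Real.tanh_lt_one β).le
  have hx_bound : ∀ x ∈ box d n,
      (#(((zdGraph d).neighborFinset x).filter (fun y => y ∉ box d n)) : ℝ) *
        (Real.tanh β * isingTwoPoint (zdGraph d) (box d n) β 0 .free 0 x) ≤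
      if Site.supNorm x = n then 2 * d * twoPointPlus d β x else 0 := by
    intro x hx
    have h2pt0 : 0 ≤ isingTwoPoint (zdGraph d) (box d n) β 0 .free 0 x :=
      isingTwoPoint_free_nonneg hgks hβ (zero_mem_box d n) hx
    have h2pt : isingTwoPoint (zdGraph d) (box d n) β 0 .free 0 x ≤ twoPointPlus d β x :=
      (isingTwoPoint_free_le_twoPointFree hmono hlim hβ (zero_mem_box d n) hx).trans
        (twoPointFree_le_twoPointPlus_holds hd hβ x)
    split_ifs with hxn
    · have hcard : (#(((zdGraph d).neighborFinset x).filter (fun y => y ∉ box d n)) : ℝ) ≤ 2 * d := by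
        have h := (Finset.card_le_card (Finset.filter_subset (fun y => y ∉ box d n)
          ((zdGraph d).neighborFinset x))).trans (card_neighborFinset_zdGraph_le x)
        exact_mod_cast h
      calc (#(((zdGraph d).neighborFinset x).filter (fun y => y ∉ box d n)) : ℝ) *
            (Real.tanh β * isingTwoPoint (zdGraph d) (box d n) β 0 .free 0 x)
          ≤ (2 * d : ℝ) * (1 * twoPointPlus d β x) := by
            refine mul_le_mul hcard ?_ (by positivity) (by positivity)
            exact mul_le_mul htanh1 h2pt h2pt0 zero_le_one
        _ = 2 * d * twoPointPlus d β x := by ring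
    · have hlt : Site.supNorm x < n := lt_of_le_of_ne (mem_box_iff_supNorm_le.1 hx) hxn
      have hempty : ((zdGraph d).neighborFinset x).filter (fun y => y ∉ box d n) = ∅ := by
        refine Finset.eq_empty_of_forall_notMem fun y hy => ?_
        obtain ⟨hy1, hy2⟩ := Finset.mem_filter.1 hy
        rw [SimpleGraph.mem_neighborFinset] at hy1
        exact hy2 (mem_box_of_adj_of_supNorm_lt hlt hy1)
      rw [hempty, Finset.card_empty]
      simp
  calc ∑ x ∈ box d n, (#(((zdGraph d).neighborFinset x).filter (fun y => y ∉ box d n)) : ℝ) *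
        (Real.tanh β * isingTwoPoint (zdGraph d) (box d n) β 0 .free 0 x)
      ≤ ∑ x ∈ box d n, (if Site.supNorm x = n then 2 * d * twoPointPlus d β x else 0) :=
        Finset.sum_le_sum hx_bound
    _ = 2 * d * ∑ y ∈ sphere d n, twoPointPlus d β y := by
        rw [← Finset.sum_filter, Finset.mul_sum]
        rfl

/-- **Sphere sums from the sharp-length window**: if `a ≤ φ_β(Λ_n)` then
`∑_{y ∈ ∂Λ_n} ⟨σ₀σ_y⟩⁺_β ≥ a/(2d)` (`β ≥ 0`, `d ≥ 1`); with `a = 1/2` this is the input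
"`φ_{ρ,β}(Λ_n) ≥ 1/2` by definition of `L(ρ,β)`" of Panis 2023, proof of Prop. 3.23, turned into
the lower bound on sphere sums used by the abundance of regular scales. [cite: Panis2023Triviality, proof of Prop. 3.23 (p. 16), first line] -/
theorem sphereSum_ge_of_dctIsingPhi (hd : 1 ≤ d) {β : ℝ} (hβ : 0 ≤ β) {n : ℕ} {a : ℝ}
    (h : a ≤ dctIsingPhi d β (box d n)) :
    a / (2 * d) ≤ ∑ y ∈ sphere d n, twoPointPlus d β y := by
  have hd0 : (0 : ℝ) < 2 * d := by
    have : (1 : ℝ) ≤ d := by exact_mod_cast hd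
    linarith
  rw [div_le_iff₀ hd0]
  have := h.trans (dctIsingPhi_box_le_sphereSum hd hβ n)
  linarith

/-- **At `β_c` the sharp-length window is all of `ℤ^d`** (`d ≥ 2`): `φ_{β_c}(S) ≥ 1 ≥ 1/2` for
every finite `S ∋ 0` (Duminil-Copin–Tassion 2016, `β̃_c = β_c`, the tree theorem
`one_le_dctIsingPhi_of_criticalBeta_le`; Panis 2023, Remark 3.22: `L^{(α)}(β_c) = ∞`). [cite: Panis2023Triviality, Remark 3.22 (p. 16)] [cite: DuminilCopinTassionCMP2016, §2.1] -/
theorem half_le_dctIsingPhi_criticalBeta (hd : 2 ≤ d) {β : ℝ} (hβ : β = criticalBeta d)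
    (S : Finset (Site d)) (h0 : (0 : Site d) ∈ S) : 1 / 2 ≤ dctIsingPhi d β S :=
  le_trans (by norm_num) (one_le_dctIsingPhi_of_criticalBeta_le hd hβ.ge S h0)

/-- **The correlation length below the sharp length** (`d = 4`): if the sphere sum at radius
`n ≥ 1` is at least `θ > 0`, then `n ξ(β)⁻¹ ≤ log(216 n³/θ)` — from `|∂Λ_n| ≤ 216 n³`,
`⟨σ₀σ_y⟩⁺ ≤ e^{-n/ξ}` on `∂Λ_n` (`twoPointPlus_le_exp_neg_supNorm`; the degenerate case
`⟨σ₀σ_{e₁}⟩⁺ = 0` would make the sphere sum vanish). [cite: FriedliVelenik2017, §3.10.7] -/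
theorem mul_invCorrLength_le_log_of_sphereSum {β θ : ℝ} (hβ : 0 ≤ β) (hθ : 0 < θ) {n : ℕ}
    (hn : 1 ≤ n) (hlb : θ ≤ ∑ y ∈ sphere 4 n, twoPointPlus 4 β y) :
    (n : ℝ) * invCorrLength (twoPointPlus 4 β) ≤ Real.log (216 * (n : ℝ) ^ 3 / θ) := by
  have h0 : ∀ y, 0 ≤ twoPointPlus 4 β y := twoPointPlus_nonneg_of_gks hβ
  -- non-degeneracy of the two-point function
  have hpos : 0 < twoPointPlus 4 β (Pi.single 0 1) := by
    by_contra hle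
    have hzero : twoPointPlus 4 β (Pi.single (⟨0, by norm_num⟩ : Fin 4) 1) = 0 :=
      le_antisymm (not_lt.1 hle) (h0 _)
    have hsum : ∑ y ∈ sphere 4 n, twoPointPlus 4 β y = 0 := by
      refine Finset.sum_eq_zero fun y hy => ?_
      have hy0 : y ≠ 0 := by
        intro h
        rw [h, mem_sphere, Site.supNorm_eq_zero_iff.2 rfl] at hy
        omega
      exact twoPointPlus_eq_zero_of_axis_eq_zero hβ (by norm_num) hzero hy0
    linarith
  set κ : ℝ := invCorrLength (twoPointPlus 4 β) with hκ
  have hterm : ∀ y ∈ sphere 4 n, twoPointPlus 4 β y ≤ Real.exp (-((n : ℝ) * κ)) := by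
    intro y hy
    have h := twoPointPlus_le_exp_neg_supNorm hβ (by norm_num) hpos y
    rw [mem_sphere.1 hy] at h
    exact h
  have hsum : ∑ y ∈ sphere 4 n, twoPointPlus 4 β y ≤ 216 * (n : ℝ) ^ 3 * Real.exp (-((n : ℝ) * κ)) := by
    calc ∑ y ∈ sphere 4 n, twoPointPlus 4 β y ≤ ∑ _y ∈ sphere 4 n, Real.exp (-((n : ℝ) * κ)) :=
          Finset.sum_le_sum hterm
      _ = #(sphere 4 n) * Real.exp (-((n : ℝ) * κ)) := by rw [Finset.sum_const, nsmul_eq_mul]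
      _ ≤ 216 * (n : ℝ) ^ 3 * Real.exp (-((n : ℝ) * κ)) := by
          gcongr
          exact card_sphere_four_le hn
  have hθ' : θ * Real.exp ((n : ℝ) * κ) ≤ 216 * (n : ℝ) ^ 3 := by
    have h := mul_le_mul_of_nonneg_right (hlb.trans hsum) (Real.exp_pos ((n : ℝ) * κ)).le
    rwa [mul_assoc, ← Real.exp_add, neg_add_cancel, Real.exp_zero, mul_one] at h
  have hexp : Real.exp ((n : ℝ) * κ) ≤ 216 * (n : ℝ) ^ 3 / θ := by
    rw [le_div_iff₀ hθ, mul_comm]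
    exact hθ'
  have hnpos : (0 : ℝ) < n := by exact_mod_cast hn
  exact (Real.le_log_iff_exp_le (by positivity)).2 hexp

end Window

/-! ### Part 3. Bubble growth in the sharp-length window (Panis 2023, Lemma 6.16, nearest-neighbour case) -/

section BubbleGrowth

/-- **Growth of the bubble diagram from sphere-sum lower bounds** (Panis 2023, Lemma 6.16
(scale to scale comparison of the bubble diagram, [ADC]), pp. 27–28: "Let `d = 4`. There exists
`C = C(d) > 0` such that for every `β ≤ β_c`, and for every `1 ≤ ℓ ≤ L ≤ L(β)`,
`B_L(β) ≤ (1 + C log₂(L/ℓ)/log₂(ℓ)) B_ℓ(β)`", here for the nearest-neighbour model on `ℤ⁴`, in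
the proof-supported form of `aizenmanDuminilCopin_bubbleDiagram_growth` —
integer scales `2 ≤ ℓ ≤ L`, dyadic-shell count `1 + log(L/ℓ)` — and with the window entering
only through what its proof uses: `β ≥ β₀ > 0` and `∑_{y ∈ ∂Λ_n} ⟨σ₀σ_y⟩⁺ ≥ θ` for `1 ≤ n ≤ L`).
Proof: `bubbleDiagram_growth_abstract` (ADC Lemma 6.3 abstract form: regular scales, dyadic
bookkeeping) with the Messager–Miracle-Solé comparison and the sliding-scale infrared bound
`χ_m/m² ≤ (C/β) χ_n/n²` (ADC Thm 5.6 = Panis Thm 3.18, a theorem of the tree,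
`aizenmanDuminilCopin_slidingScaleInfraredBound_holds`), the two-point function of
`μ ∈ 𝒢(β, 0)` being the plus one (`twoPoint_eq_twoPointPlus_of_isingGibbsMeasure`). [cite: Panis2023Triviality, Lemma 6.16 (pp. 27–28)] [cite: AizenmanDuminilCopinAnnals2021, arXiv:1912.07973 Lemma 6.3 and its proof (p. 21)] -/
theorem bubbleDiagram_growth_of_sphereSum {β₀ θ : ℝ} (hβ₀ : 0 < β₀) (hθ : 0 < θ) (hθ1 : θ ≤ 1) :
    ∃ C : ℝ, 0 < C ∧ ∀ (β : ℝ) (ℓ L : ℕ), β₀ ≤ β → β ≤ criticalBeta 4 → 2 ≤ ℓ → ℓ ≤ L →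
      (∀ n : ℕ, 1 ≤ n → n ≤ L → θ ≤ ∑ y ∈ sphere 4 n, twoPointPlus 4 β y) →
      ∀ μ ∈ isingGibbsMeasures 4 β 0,
        bubbleDiagram (twoPoint μ spinAt 0) L ≤
          (1 + C * (1 + Real.log ((L : ℝ) / ℓ)) / Real.log ℓ) * bubbleDiagram (twoPoint μ spinAt 0) ℓ := by
  obtain ⟨C_T, hC_T, hT4⟩ := aizenmanDuminilCopin_slidingScaleInfraredBound_holds (d := 4) (by norm_num)
  set K : ℝ := max (C_T / β₀) 1 with hK
  have hK1 : 1 ≤ K := le_max_right _ _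
  obtain ⟨C, hC, hmain⟩ := bubbleDiagram_growth_abstract K θ hK1 hθ hθ1
  refine ⟨C, hC, ?_⟩
  intro β ℓ L hββ₀ hβc hℓ2 hℓL hLB μ hμ
  have hβpos : 0 < β := hβ₀.trans_le hββ₀
  have hβ0 : 0 ≤ β := hβpos.le
  have hS := twoPoint_eq_twoPointPlus_of_isingGibbsMeasure hβ0 hβc hμ
  rw [hS]
  have h0 : ∀ x, 0 ≤ twoPointPlus 4 β x := twoPointPlus_nonneg_of_gks hβ0
  have h1 : ∀ x, twoPointPlus 4 β x ≤ 1 := twoPointPlus_le_one_of_nonneg hβ0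
  have hS0 : twoPointPlus 4 β 0 = 1 := twoPointPlus_zero 4 β
  have hMMS : ∀ x y : Site 4, 4 * Site.supNorm x ≤ Site.supNorm y →
      twoPointPlus 4 β y ≤ twoPointPlus 4 β x :=
    fun x y h => twoPointPlus_le_of_mul_supNorm_le hβ0 h
  have hTK : ∀ n m : ℕ, 1 ≤ n → n ≤ m →
      boxSusceptibility (twoPointPlus 4 β) (m : ℕ) / (m : ℝ) ^ 2 ≤
        K * (boxSusceptibility (twoPointPlus 4 β) (n : ℕ) / (n : ℝ) ^ 2) := by
    intro n m hn hnm
    have h := hT4 β n m hβpos hβc (by exact_mod_cast hn) (by exact_mod_cast hnm) μ hμ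
    rw [hS] at h
    refine h.trans (mul_le_mul_of_nonneg_right ?_
      (div_nonneg (boxSusceptibility_nonneg h0 _) (sq_nonneg _)))
    calc C_T / β ≤ C_T / β₀ := div_le_div_of_nonneg_left hC_T.le hβ₀ hββ₀
      _ ≤ K := le_max_left _ _
  exact hmain _ h0 h1 hS0 hMMS hTK ℓ L hℓ2 hℓL hLB

end BubbleGrowth


/-- **The ADC window at the quarter scale** (the arithmetic of step 3 of the module docstring):
for `L ≥ 33` with `log L = y ≥ 32`, `ℓ ≥ 2`, `ℓ⁴ = L`, `log ℓ = y/4`, the sphere-sum bound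
`∑_{∂Λ_{⌊16L⌋}} ⟨σ₀σ_y⟩⁺ ≥ 1/16` gives `ℓ ξ(β)⁻¹ ≤ 1`: indeed `⌊16L⌋ ξ⁻¹ ≤ log(3456 ⌊16L⌋³) ≤ 4y`
(`mul_invCorrLength_le_log_of_sphereSum`, `log 3456 ≤ 12 log 2 ≤ 9`, `log ⌊16L⌋ ≤ 3 + y`) and
`4yℓ ≤ 16ℓ² ≤ 15ℓ⁴ = 15L ≤ ⌊16L⌋`. [folklore] -/
theorem quarterScale_mul_invCorrLength_le_one {β L ℓ y : ℝ} (hβ : 0 ≤ β) (hL33 : 33 ≤ L)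
    (hy_def : Real.log L = y) (hy32 : 32 ≤ y) (hℓ2 : 2 ≤ ℓ) (hℓ4 : ℓ ^ 4 = L)
    (hlogℓ : Real.log ℓ = y / 4)
    (hsph : (1 : ℝ) / 16 ≤ ∑ z ∈ sphere 4 ⌊16 * L⌋₊, twoPointPlus 4 β z) :
    ℓ * invCorrLength (twoPointPlus 4 β) ≤ 1 := by
  have hL0 : 0 < L := by linarith
  have hLne : L ≠ 0 := hL0.ne'
  have hℓ0 : 0 ≤ ℓ := by linarith
  have hℓpos : 0 < ℓ := by linarith
  set N₁ : ℕ := ⌊16 * L⌋₊ with hN₁_def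
  have hN₁le : (N₁ : ℝ) ≤ 16 * L := Nat.floor_le (by linarith)
  have hN₁gt : 16 * L < (N₁ : ℝ) + 1 := Nat.lt_floor_add_one (16 * L)
  have hN₁ge : 15 * L ≤ (N₁ : ℝ) := by linarith
  have hN₁pos : (0 : ℝ) < N₁ := by linarith
  have hN₁1 : 1 ≤ N₁ := by exact_mod_cast (show (1 : ℝ) ≤ N₁ by linarith)
  have hκ := mul_invCorrLength_le_log_of_sphereSum hβ (θ := 1 / 16) (by norm_num) hN₁1 hsph
  set κ : ℝ := invCorrLength (twoPointPlus 4 β) with hκ_def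
  have hlog2 : Real.log 2 < 0.6931471808 := Real.log_two_lt_d9
  have hlogN₁ : Real.log (N₁ : ℝ) ≤ 3 + y := by
    have h1 : Real.log (N₁ : ℝ) ≤ Real.log (16 * L) := Real.log_le_log hN₁pos hN₁le
    have h2 : Real.log (16 * L) = Real.log 16 + Real.log L := Real.log_mul (by norm_num) hLne
    have h3 : Real.log 16 = 4 * Real.log 2 := by
      rw [show (16 : ℝ) = 2 ^ 4 by norm_num, Real.log_pow]
      norm_num
    rw [hy_def] at h2
    linarith
  have hlog3456 : Real.log (3456 : ℝ) ≤ 9 := by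
    have h1 : Real.log (3456 : ℝ) ≤ Real.log ((2 : ℝ) ^ 12) :=
      Real.log_le_log (by norm_num) (by norm_num)
    rw [Real.log_pow] at h1
    push_cast at h1
    linarith
  have hbound : Real.log (216 * (N₁ : ℝ) ^ 3 / (1 / 16)) ≤ 4 * y := by
    have h1 : (216 * (N₁ : ℝ) ^ 3 / (1 / 16)) = 3456 * (N₁ : ℝ) ^ 3 := by ring
    rw [h1, Real.log_mul (by norm_num) (by positivity), Real.log_pow]
    push_cast
    linarith
  have hN₁κ : (N₁ : ℝ) * κ ≤ 4 * y := hκ.trans hbound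
  have hyℓ : y ≤ 4 * ℓ := by
    have h1 : Real.log ℓ ≤ ℓ - 1 := Real.log_le_sub_one_of_pos hℓpos
    rw [hlogℓ] at h1
    linarith
  have h4yℓ : 4 * y * ℓ ≤ 15 * L := by
    have hy0 : 0 ≤ y := by
      have : 0 ≤ Real.log ℓ := Real.log_nonneg (by linarith)
      rw [hlogℓ] at this
      linarith
    calc 4 * y * ℓ ≤ 4 * (4 * ℓ) * ℓ := by gcongr
      _ = 16 * ℓ ^ 2 := by ring
      _ ≤ 15 * ℓ ^ 4 := by
          have hℓsq : 4 ≤ ℓ ^ 2 := by nlinarith [hℓ2]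
          have h4 : ℓ ^ 4 = ℓ ^ 2 * ℓ ^ 2 := by ring
          rw [h4]
          nlinarith [hℓsq]
      _ = 15 * L := by rw [hℓ4]
  have key : ℓ * κ * (N₁ : ℝ) ≤ 1 * (N₁ : ℝ) := by
    calc ℓ * κ * (N₁ : ℝ) = ℓ * ((N₁ : ℝ) * κ) := by ring
      _ ≤ ℓ * (4 * y) := mul_le_mul_of_nonneg_left hN₁κ hℓ0
      _ = 4 * y * ℓ := by ring
      _ ≤ 15 * L := h4yℓ
      _ ≤ N₁ := hN₁ge
      _ = 1 * (N₁ : ℝ) := (one_mul _).symm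
  exact le_of_mul_le_mul_right key hN₁pos

/-! ### Part 4. Panis 2023, Corollary 1.8 (`d = 4`, nearest-neighbour model) from ADC Theorem 1.3 -/

section Assembly

set_option maxHeartbeats 4000000 in
/-- **Panis 2023, Corollary 1.8 — the bound on `S(β, L, f)` in the sharp-length window, `d = 4`,
nearest-neighbour model — from Aizenman–Duminil-Copin 2021, Theorem 1.3.** The named fact
`panis_ursellFourSum_le_four` (`HighDimTrivialityUniform`: there are `C, c, γ > 0` with
`Σ_L⁻² ∑_{x ∈ Λ_{rL}⁴} |U₄^μ(x)| ≤ C r^γ (log L)^{-c}` for `0 ≤ β ≤ β_c(4)`, `L > 1`, `r ≥ 1`,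
`μ ∈ 𝒢(β, 0)`, whenever `β = β_c` or `φ_β(S) ≥ 1/2` for every finite `S ∋ 0` inside `Λ_{16L}`;
Panis, Ann. Probab. 54 (2026) = arXiv:2309.05797, Cor. 1.8 and its proof §6.6, p. 33: "Applying
the improved tree diagram bound we obtain `S(β,L,f) ≤ C ∑ … /(B_{L(x₁,x₂,x₃,x₄)}(β)^c Σ_L(β)²)` …
We now fix `a ∈ (0,1)`. The strategy consists in splitting the right-hand side according to …
`L(x₁,x₂,x₃,x₄) ≤ L^a` … `> L^a`. From there the conclusion builds on the same tools as the ones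
used in Section 5, and also on Lemma 6.16", "We refer to [ADC] for the details of the proof")
follows from the single named fact `aizenmanDuminilCopin_improvedTreeDiagramBound` (ADC Thm 1.3, window
`L ≤ ξ(β)`), everything else being a theorem of the tree. The proof is that of
`aizenmanDuminilCopin_ursellFourSum_le_of_facts` (ADC §6.3, pp. 26–27: the regimes `L ≤ e³²`,
`β ≤ β₀`, and the window regime with Thm 1.3 at scale `ℓ = L^{1/4}`, the split of `∑|U₄|`, the
sliding-scale infrared bound — a theorem, `aizenmanDuminilCopin_slidingScaleInfraredBound_holds` —
`Σ_L ≥ L⁴χ_L/(256D)`, bubble growth twice and the logarithmic gain), with the sharp-length window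
feeding (i) the bubble growth through the sphere sums `∑_{∂Λ_n} ⟨σ₀σ_y⟩⁺ ≥ 1/16`, `n ≤ 16L`
(`bubbleDiagram_growth_of_sphereSum`, Panis Lemma 6.16) and (ii) the ADC window at scale `ℓ`,
`L^{1/4} ξ(β)⁻¹ ≤ 1`, through Fekete's bound `⟨σ₀σ_y⟩⁺ ≤ e^{-‖y‖_∞/ξ}` and the sphere sum at
radius `⌊16L⌋` (`mul_invCorrLength_le_log_of_sphereSum`: `⌊16L⌋ ξ⁻¹ ≤ log(3456 ⌊16L⌋³) ≤ 4 log L`).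
Exponents: `γ = 12`, `c = min(c₁, 1)/2` with `c₁` the exponent of Thm 1.3. Once Thm 1.3 is
discharged, `panis_ursellFourSum_le_four_holds` is this theorem applied to
`aizenmanDuminilCopin_improvedTreeDiagramBound_holds`. [cite: Panis2023Triviality, Cor. 1.8 and its proof §6.6 (p. 33), with Def. 3.21, Rem. 3.22 and Lemma 6.16] [cite: AizenmanDuminilCopinAnnals2021, arXiv:1912.07973 Thm 1.3 (p. 6) and §6.3 (pp. 26–27)] -/
theorem panis_ursellFourSum_le_four_of_improvedTreeDiagramBound
    (h13 : aizenmanDuminilCopin_improvedTreeDiagramBound) :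
    panis_ursellFourSum_le_four := by
  classical
  -- ### the inputs that are theorems of the tree
  have h56 : aizenmanDuminilCopin_slidingScaleInfraredBound :=
    aizenmanDuminilCopin_slidingScaleInfraredBound_holds
  have hU₁ : ∀ {d : ℕ} {β : ℝ}, hasUniqueGibbsMeasure_of_lt_criticalBeta (d := d) (β := β) :=
    fun {d} {β} => hasUniqueGibbsMeasure_of_lt_criticalBeta_holds
  have hU₂ : ∀ {d : ℕ}, hasUniqueGibbsMeasure_criticalBeta (d := d) :=
    fun {d} => hasUniqueGibbsMeasure_criticalBeta_holds
  -- ### the constants of the inputs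
  obtain ⟨c₁, C₁, hc₁, hC₁, H13⟩ := h13
  obtain ⟨β₀, hβ₀, hφ₀⟩ := exists_beta_dctIsingPhi_singleton_lt (d := 4)
  -- bubble growth in the sharp-length window (Panis Lemma 6.16), sphere sums `≥ 1/16`, `β ≥ β₀`
  obtain ⟨C₂, hC₂, H63⟩ :=
    bubbleDiagram_growth_of_sphereSum hβ₀ (θ := 1 / 16) (by norm_num) (by norm_num)
  obtain ⟨C₃, hC₃, H56⟩ := h56 (d := 4) (by norm_num)
  obtain ⟨C₀, hC₀⟩ := twoPointFree_criticalBeta_upper_holds (d := 4) (by norm_num)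
  obtain ⟨Cχ, hCχ0, hCχ⟩ := exists_sum_box_twoPointFree_le_sq
  have hF : ∀ (d : ℕ) {β : ℝ}, exists_freeMeasure d (β := β) 0 := fun d => exists_freeMeasure_holds d 0
  have hTBdlr := treeDiagramBound_dlr_of_treeDiagramBound
    Literature.Barriers.CriticalPhenomena.treeDiagramBound_holds hU₁ hU₂ hF (d := 4) (by norm_num)
  have hlim : hasBoxLimit_isingCorr_free 4 := hasBoxLimit_isingCorr_free_holds
  have hgks : ∀ {Λ A : Finset (Site 4)} {β h : ℝ} {bc : BoundaryCondition (Site 4)},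
      gks_one (zdGraph 4) (Λ := Λ) (A := A) (β := β) (h := h) (bc := bc) :=
    GKSInequalities.gks_one_holds (zdGraph 4)
  have hβmono : isingCorr_free_mono_beta (d := 4) := isingCorr_free_mono_beta_of_gks_two
    fun _ _ _ _ _ _ => GKSInequalities.gks_two_holds (zdGraph 4)
  -- ### derived constants
  set A₀ : ℝ := max C₀ 1 with hA₀_def
  have hA₀ : 0 ≤ A₀ := le_trans zero_le_one (le_max_right _ _)
  set Cχ' : ℝ := 4 * Cχ with hCχ'_def
  have hCχ' : 0 ≤ Cχ' := by positivity
  set D : ℝ := C₃ / β₀ with hD_def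
  have hD : 0 ≤ D := by positivity
  set K_C : ℝ := 2 * (6 ^ 4 * 9 ^ 4 * Cχ' ^ 4 + 54 * 81 ^ 4 * 256 * A₀ ^ 4) with hK_C_def
  have hK_C : 0 ≤ K_C := by positivity
  set K₄ : ℝ := 48 ^ 4 * 289 ^ 4 + 54 * 81 ^ 4 * 4096 with hK₄_def
  set K₃ : ℝ := 48 ^ 4 * 289 ^ 3 + 108 * 81 ^ 3 * 4096 with hK₃_def
  set C₅ : ℝ := 1 + 16 * C₂ with hC₅_def
  have hC₅ : 0 ≤ C₅ := by positivity
  set T₀ : ℝ := Cχ' ^ 2 with hT₀_def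
  set K₈ : ℝ := C₅ * (3 * (2 * T₀ + 324 * C₂)) with hK₈_def
  have hK₈ : 0 ≤ K₈ := by positivity
  set c' : ℝ := min c₁ 1 with hc'_def
  have hc' : 0 < c' := lt_min hc₁ one_pos
  have hc'1 : c' ≤ 1 := min_le_right _ _
  have hc'c₁ : c' ≤ c₁ := min_le_left _ _
  set c : ℝ := c' / 2 with hc_def
  have hc : 0 < c := by positivity
  have hc1 : c ≤ 1 := by linarith
  set K_B1 : ℝ := (256 * D) ^ 2 * C₁ * K₄ * D ^ 4 * T₀ ^ (1 - c') * K₈ ^ c' with hK_B1_def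
  have hK_B1 : 0 ≤ K_B1 := by positivity
  set K_B2 : ℝ := (256 * D) ^ 2 * 2592 * K₃ * D ^ 3 * Cχ' with hK_B2_def
  have hK_B2 : 0 ≤ K_B2 := by positivity
  set L₀ : ℝ := Real.exp 32 with hL₀_def
  have hL₀1 : 1 < L₀ := by rw [hL₀_def]; exact Real.one_lt_exp_iff.2 (by norm_num)
  have hlogL₀ : Real.log L₀ = 32 := by rw [hL₀_def, Real.log_exp]
  have hX0 : 0 ≤ K_C * L₀ ^ 12 * Real.log L₀ ^ c := by
    have : 0 ≤ Real.log L₀ ^ c := Real.rpow_nonneg (by rw [hlogL₀]; norm_num) c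
    positivity
  obtain ⟨C, hC_C, hC_A, hC_B, hCpos⟩ : ∃ C : ℝ, K_C * L₀ ^ 12 * Real.log L₀ ^ c ≤ C ∧
      32 * 12 ^ 4 ≤ C ∧ K_B1 + K_B2 ≤ C ∧ 0 < C :=
    ⟨K_C * L₀ ^ 12 * Real.log L₀ ^ c + 32 * 12 ^ 4 + (K_B1 + K_B2) + 1,
      by linarith, by linarith, by linarith, by positivity⟩
  refine ⟨C, c, 12, hCpos, hc, by norm_num, fun β L r hβ hβc hL hr hWP μ hμ => ?_⟩
  rw [show r ^ (12 : ℝ) = r ^ (12 : ℕ) from by exact_mod_cast Real.rpow_natCast r 12]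
  -- ### the sharp-length window: `φ_β(S) ≥ 1/2` for every `S ∋ 0` inside `Λ_{16L}`
  -- (at `β_c` for every `S ∋ 0`: Panis Rem. 3.22, `L(β_c) = ∞`)
  have hφ : ∀ S : Finset (Site 4), (0 : Site 4) ∈ S → S ⊆ latticeBox 4 (16 * L) →
      1 / 2 ≤ dctIsingPhi 4 β S := by
    rcases hWP with h | h
    · exact fun S h0 _ => half_le_dctIsingPhi_criticalBeta (by norm_num) h S h0
    · exact h
  -- sphere sums `∑_{∂Λ_m} ⟨σ₀σ_y⟩⁺ ≥ 1/16` up to radius `⌊16L⌋`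
  have hsph : ∀ m : ℕ, m ≤ ⌊16 * L⌋₊ → (1 : ℝ) / 16 ≤ ∑ y ∈ sphere 4 m, twoPointPlus 4 β y := by
    intro m hm
    have hsub : box 4 m ⊆ latticeBox 4 (16 * L) := by
      rw [latticeBox_eq_box (by linarith : (0 : ℝ) ≤ 16 * L)]
      exact box_mono 4 hm
    have h := sphereSum_ge_of_dctIsingPhi (d := 4) (by norm_num) hβ
      (hφ (box 4 m) (zero_mem_box 4 m) hsub)
    have h16 : (1 : ℝ) / 2 / (2 * ((4 : ℕ) : ℝ)) = 1 / 16 := by norm_num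
    rw [h16] at h
    exact h
  -- ### the state and its two-point function
  obtain ⟨hP, hS⟩ := isingGibbsMeasure_twoPoint_of_facts hU₁ hU₂ hF (by norm_num) hβ hβc hμ
  haveI := hP
  set S : Site 4 → ℝ := twoPointFree 4 β with hSdef
  have hS0 : ∀ v, 0 ≤ S v := fun v => twoPointFree_nonneg hlim hgks hβ v
  have hS1 : ∀ v, S v ≤ 1 := fun v => twoPointFree_le_one hlim hβ v
  have hSz : S 0 = 1 := twoPointFree_zero 4 β
  have hS' : ∀ x y, ∫ σ, spinAt x σ * spinAt y σ ∂μ = S (x - y) := by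
    intro x y
    rw [← hS y x]
    exact integral_congr_ae (ae_of_all _ fun σ => mul_comm _ _)
  have htp : ∀ u v, twoPoint μ spinAt u v = S (v - u) := fun u v => hS u v
  have htp0 : twoPoint μ spinAt 0 = S := by
    funext v; rw [htp, sub_zero]
  have hG : ∀ x y, 0 ≤ ∫ σ, spinAt x σ * spinAt y σ ∂μ := fun x y => by rw [hS]; exact hS0 _
  -- infrared decay, summability
  have hIR : ∀ v : Site 4, (1 : ℝ) ≤ Site.supNorm v → S v ≤ A₀ / (Site.supNorm v : ℝ) ^ 2 := by
    intro v hv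
    have hv0 : v ≠ 0 := by
      intro h; rw [h, Site.supNorm_eq_zero_iff.2 rfl] at hv; norm_num at hv
    have hnorm : (‖v‖ : ℝ) = Site.supNorm v := Site.norm_eq_supNorm v
    have hpos : (0 : ℝ) < Site.supNorm v := by linarith
    calc S v ≤ twoPointFree 4 (criticalBeta 4) v := twoPointFree_mono_beta hβmono hlim hβ hβc v
      _ ≤ C₀ * (‖v‖ : ℝ) ^ (-(((4 : ℕ) : ℝ) - 2)) := hC₀ v hv0
      _ = C₀ / (Site.supNorm v : ℝ) ^ 2 := by
          rw [hnorm, show (-(((4 : ℕ) : ℝ) - 2)) = -(2 : ℝ) by norm_num, Real.rpow_neg hpos.le,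
            Real.rpow_two, div_eq_mul_inv]
      _ ≤ A₀ / (Site.supNorm v : ℝ) ^ 2 := by
          gcongr; exact le_max_left _ _
  have h4 : Summable (fun v => S v ^ 4) :=
    summable_pow_four_of_decay hS0 hS1 (R := 2) (by norm_num) (fun v hv => hIR v (by linarith))
  have hsumx := summable_prod_shift hS0 h4
  -- the tree diagram bound for `μ`
  have hTB : ∀ x : Fin 4 → Site 4, |connectedFour μ spinAt x| ≤ 2 * ∑' u, ∏ i, S (x i - u) := by
    intro x
    have h := hTBdlr β hβ hβc μ hμ x
    simp_rw [hS'] at h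
    exact h (hsumx x)
  -- susceptibility bounds
  have hχS : ∀ t : ℝ, 1 ≤ t → boxSusceptibility S t ≤ Cχ' * t ^ 2 := fun t ht =>
    boxSusceptibility_le_sq_of_nat hCχ0.le (hCχ β hβ hβc) ht
  have hSig1 : 1 ≤ blockSpinVariance μ L := one_le_blockSpinVariance μ hG (by linarith)
  have hSigpos : 0 < blockSpinVariance μ L := by linarith
  have hnum0 : 0 ≤ ∑ x ∈ Fintype.piFinset (fun _ : Fin 4 => latticeBox 4 (r * L)),
      |connectedFour μ spinAt x| := Finset.sum_nonneg fun x _ => abs_nonneg _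
  have hlog0 : 0 < Real.log L := Real.log_pos hL
  have hlogc0 : 0 < Real.log L ^ c := Real.rpow_pos_of_pos hlog0 c
  have hr0 : 0 < r := by linarith
  have hrL : 1 ≤ r * L := by nlinarith
  -- ### Regime C: `L ≤ L₀`
  by_cases hLL₀ : L ≤ L₀
  · have hnum := sum_abs_le_crude hS0 h4 hA₀ hIR hχS hTB hrL
    have hlogle : Real.log L ^ c ≤ Real.log L₀ ^ c :=
      Real.rpow_le_rpow hlog0.le (Real.log_le_log (by linarith) hLL₀) hc.le
    rw [ursellFourSum, div_le_div_iff₀ (pow_pos hSigpos 2) hlogc0]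
    calc (∑ x ∈ Fintype.piFinset (fun _ : Fin 4 => latticeBox 4 (r * L)), |connectedFour μ spinAt x|) *
          Real.log L ^ c
        ≤ (K_C * (r * L) ^ 12) * Real.log L₀ ^ c := by gcongr
      _ = (K_C * L ^ 12 * Real.log L₀ ^ c) * r ^ 12 * 1 ^ 2 := by ring
      _ ≤ (K_C * L₀ ^ 12 * Real.log L₀ ^ c) * r ^ 12 * blockSpinVariance μ L ^ 2 := by
          gcongr
      _ ≤ C * r ^ 12 * blockSpinVariance μ L ^ 2 := by
          gcongr
  -- now `L > L₀`
  push Not at hLL₀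
  have hL₀L : L₀ ≤ L := hLL₀.le
  have hlog32 : 32 ≤ Real.log L := by rw [← hlogL₀]; exact Real.log_le_log (by linarith) hL₀L
  have hL33 : 33 ≤ L := by
    have : (32 : ℝ) + 1 ≤ Real.exp 32 := Real.add_one_le_exp 32
    linarith
  have hlogcL : Real.log L ^ c ≤ L := rpow_log_le_self hL hc hc1
  -- ### Regime A: high temperature
  by_cases hββ₀ : β ≤ β₀
  · have hA := ursellFourSum_le_of_le_smallBeta hU₁ hU₂ hF (by norm_num) hβ₀ hφ₀ hβ hββ₀ hβc hμ
      (hTBdlr β hβ hβc μ hμ) (L := L) (r := r) (by linarith) hr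
    refine hA.trans ?_
    rw [div_le_div_iff₀ (by positivity) hlogc0]
    calc 32 * 12 ^ 4 * r ^ 4 * Real.log L ^ c ≤ 32 * 12 ^ 4 * r ^ 12 * L ^ 4 := by
          have h1 : r ^ 4 ≤ r ^ 12 := pow_le_pow_right₀ hr (by norm_num)
          have h2 : Real.log L ^ c ≤ L ^ 4 := hlogcL.trans (le_self_pow₀ hL.le (by norm_num))
          exact mul_le_mul (mul_le_mul_of_nonneg_left h1 (by positivity)) h2 hlogc0.le (by positivity)
      _ ≤ C * r ^ 12 * L ^ 4 := by
          gcongr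
  -- ### Regime B: the sharp-length window, `β > β₀`, `L > L₀`
  push Not at hββ₀
  have hβpos : 0 < β := hβ₀.trans hββ₀
  obtain ⟨y, hy_def⟩ : ∃ y : ℝ, Real.log L = y := ⟨_, rfl⟩
  rw [hy_def] at hlog32 hlogcL hlogc0 hlog0 ⊢
  have hy32 : 32 ≤ y := hlog32
  have hy1 : 1 ≤ y := by linarith
  have hy0 : 0 < y := by linarith
  have hL0 : 0 < L := by linarith
  have hLne : L ≠ 0 := hL0.ne'
  have hrne : r ≠ 0 := hr0.ne'
  have hL1 : 1 ≤ L := hL.le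
  have hL4 : 4 ≤ L := by linarith
  have hL16 : 16 ≤ L := by linarith
  have hDpos : 0 < D := div_pos hC₃ hβ₀
  have hDne : D ≠ 0 := hDpos.ne'
  -- the scale `ℓ = L^{1/4}`
  set ℓ : ℝ := Real.sqrt (Real.sqrt L) with hℓ_def
  have hℓ0 : 0 ≤ ℓ := Real.sqrt_nonneg _
  have hℓ4 : ℓ ^ 4 = L := by
    rw [hℓ_def, show (4 : ℕ) = 2 * 2 from rfl, pow_mul, Real.sq_sqrt (Real.sqrt_nonneg _),
      Real.sq_sqrt hL0.le]
  have h16 : Real.sqrt 16 = 4 := by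
    rw [show (16 : ℝ) = 4 ^ 2 by norm_num, Real.sqrt_sq (by norm_num)]
  have h4' : Real.sqrt 4 = 2 := by
    rw [show (4 : ℝ) = 2 ^ 2 by norm_num, Real.sqrt_sq (by norm_num)]
  have hℓ2 : 2 ≤ ℓ := by
    rw [← h4', ← h16, hℓ_def]
    exact Real.sqrt_le_sqrt (Real.sqrt_le_sqrt hL16)
  have hℓ1 : 1 ≤ ℓ := by linarith
  have hℓpos : 0 < ℓ := by linarith
  have hℓL : ℓ ≤ L := by rw [← hℓ4]; exact le_self_pow₀ hℓ1 (by norm_num)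
  have hlogℓ : Real.log ℓ = y / 4 := by
    rw [hℓ_def, Real.log_sqrt (Real.sqrt_nonneg _), Real.log_sqrt hL0.le, hy_def]; ring
  set n : ℕ := ⌊ℓ⌋₊ with hn_def
  have hn2 : 2 ≤ n := Nat.le_floor (by exact_mod_cast hℓ2)
  have hnℓ : (n : ℝ) ≤ ℓ := Nat.floor_le hℓ0
  have hn_gt : ℓ < (n : ℝ) + 1 := Nat.lt_floor_add_one ℓ
  have hn2r : (2 : ℝ) ≤ n := by exact_mod_cast hn2
  have hnpos : (0 : ℝ) < n := by linarith
  set N : ℕ := ⌊L⌋₊ with hN_def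
  have hNL : (N : ℝ) ≤ L := Nat.floor_le hL0.le
  have hN_gt : L < (N : ℝ) + 1 := Nat.lt_floor_add_one L
  have hnN : n ≤ N := Nat.floor_le_floor hℓL
  have hN16 : N ≤ ⌊16 * L⌋₊ := Nat.floor_le_floor (by linarith)
  have hsphN : ∀ m : ℕ, 1 ≤ m → m ≤ N → (1 : ℝ) / 16 ≤ ∑ y ∈ sphere 4 m, twoPointPlus 4 β y :=
    fun m _ hm => hsph m (hm.trans hN16)
  -- the sliding-scale bound with constant `D = C₃/β₀`, and Messager–Miracle-Solé
  have h56' : ∀ ℓ' L' : ℝ, 1 ≤ ℓ' → ℓ' ≤ L' →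
      boxSusceptibility S L' / L' ^ 2 ≤ D * (boxSusceptibility S ℓ' / ℓ' ^ 2) := by
    intro ℓ' L' h1 h2
    have h := H56 β ℓ' L' hβpos hβc h1 h2 μ hμ
    rw [htp0] at h
    refine h.trans (mul_le_mul_of_nonneg_right ?_
      (div_nonneg (boxSusceptibility_nonneg hS0 _) (sq_nonneg _)))
    rw [hD_def]
    exact div_le_div_of_nonneg_left hC₃.le hβ₀ hββ₀.le
  have hMMS : ∀ z w : Site 4, 4 * Site.supNorm w ≤ Site.supNorm z → S z ≤ S w :=
    fun z w h => twoPointFree_le_of_mul_supNorm_le hβ (by norm_num) h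
  -- the box `Λ_{rL}`
  set t : ℝ := r * L with ht_def
  have ht1 : 1 ≤ t := hrL
  have htL : L ≤ t := le_mul_of_one_le_left hL0.le hr
  have ht0 : 0 < t := by linarith
  have htne : t ≠ 0 := ht0.ne'
  have hχL0 : 0 ≤ boxSusceptibility S L := boxSusceptibility_nonneg hS0 _
  have hχL1 : 1 ≤ boxSusceptibility S L := by
    rw [boxSusceptibility]
    calc (1 : ℝ) = S 0 := hSz.symm
      _ ≤ _ := Finset.single_le_sum (f := S) (fun v _ => hS0 v) (zero_mem_latticeBox hL0.le)
  have hχLne : boxSusceptibility S L ≠ 0 := by linarith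
  have hχLle : boxSusceptibility S L ≤ Cχ' * L ^ 2 := hχS L hL1
  set A : ℝ := 16 * D * boxSusceptibility S L / L ^ 2 with hA_def
  have hA0' : 0 ≤ A := by positivity
  have hSA : ∀ v : Site 4, 16 * t / 2 ≤ (Site.supNorm v : ℝ) →
      S v ≤ A / (Site.supNorm v : ℝ) ^ 2 := by
    intro v hv
    exact twoPointFn_le_of_mms_sliding hS0 hMMS hD h56' hL1 (v := v) (by linarith)
  obtain ⟨-, hW4⟩ := summable_tsum_shiftSum_pow_four_le hS0 ht1 (R := 16 * t) (by linarith) hA0' hSA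
  obtain ⟨hW3s, hW3⟩ := summable_tsum_shiftSum_pow_three_le hS0 ht1 (R := 16 * t) (by linarith) hA0' hSA
  have hχ17 : boxSusceptibility S (t + 16 * t) ≤ 289 * D * boxSusceptibility S L * r ^ 2 := by
    have h := h56' L (17 * t) hL1 (by linarith)
    rw [div_le_iff₀ (by positivity)] at h
    rw [show t + 16 * t = 17 * t by ring]
    refine h.trans (le_of_eq ?_)
    rw [ht_def]
    field_simp
    ring
  have hχ17_0 : 0 ≤ boxSusceptibility S (t + 16 * t) := boxSusceptibility_nonneg hS0 _
  have hcard16 : (#(latticeBox 4 (16 * t)) : ℝ) ≤ (3 * (16 * t)) ^ 4 := card_latticeBox_le (by linarith)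
  have hcardt : (#(latticeBox 4 t) : ℝ) ≤ (3 * t) ^ 4 := card_latticeBox_le ht1
  have hfl16 : 8 * t ≤ (⌊16 * t⌋₊ : ℝ) := by
    have := Nat.lt_floor_add_one (16 * t); linarith
  have hW4' : ∑' u, (∑ a ∈ latticeBox 4 t, S (a - u)) ^ 4 ≤
      K₄ * D ^ 4 * r ^ 12 * L ^ 4 * boxSusceptibility S L ^ 4 := by
    calc ∑' u, (∑ a ∈ latticeBox 4 t, S (a - u)) ^ 4
        ≤ #(latticeBox 4 (16 * t)) * boxSusceptibility S (t + 16 * t) ^ 4 +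
            54 * ((#(latticeBox 4 t) : ℝ) * (4 * A)) ^ 4 / (⌊16 * t⌋₊ : ℝ) ^ 4 := hW4
      _ ≤ (3 * (16 * t)) ^ 4 * (289 * D * boxSusceptibility S L * r ^ 2) ^ 4 +
            54 * ((3 * t) ^ 4 * (4 * A)) ^ 4 / (8 * t) ^ 4 := by
          gcongr
      _ = K₄ * D ^ 4 * r ^ 12 * L ^ 4 * boxSusceptibility S L ^ 4 := by
          rw [hK₄_def, hA_def, ht_def]
          field_simp
          ring
  have hW3' : ∑' u, (∑ a ∈ latticeBox 4 t, S (a - u)) ^ 3 ≤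
      K₃ * D ^ 3 * r ^ 10 * L ^ 4 * boxSusceptibility S L ^ 3 := by
    calc ∑' u, (∑ a ∈ latticeBox 4 t, S (a - u)) ^ 3
        ≤ #(latticeBox 4 (16 * t)) * boxSusceptibility S (t + 16 * t) ^ 3 +
            108 * ((#(latticeBox 4 t) : ℝ) * (4 * A)) ^ 3 / (⌊16 * t⌋₊ : ℝ) ^ 2 := hW3
      _ ≤ (3 * (16 * t)) ^ 4 * (289 * D * boxSusceptibility S L * r ^ 2) ^ 3 +
            108 * ((3 * t) ^ 4 * (4 * A)) ^ 3 / (8 * t) ^ 2 := by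
          gcongr
      _ = K₃ * D ^ 3 * r ^ 10 * L ^ 4 * boxSusceptibility S L ^ 3 := by
          rw [hK₃_def, hA_def, ht_def]
          field_simp
          ring
  have hW3_0 : 0 ≤ ∑' u, (∑ a ∈ latticeBox 4 t, S (a - u)) ^ 3 :=
    tsum_nonneg fun u => pow_nonneg (Finset.sum_nonneg fun a _ => hS0 _) 3
  -- the improved tree diagram bound at scale `ℓ`
  set Bℓ : ℝ := bubbleDiagram S ℓ with hBℓ_def
  have hBℓ1 : 1 ≤ Bℓ := one_le_bubbleDiagram hSz hℓ0
  have hBℓ0 : 0 < Bℓ := by linarith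
  have hBℓc : 0 < Bℓ ^ c₁ := Real.rpow_pos_of_pos hBℓ0 c₁
  have hBℓcne : Bℓ ^ c₁ ≠ 0 := hBℓc.ne'
  set K₁ : ℝ := C₁ / Bℓ ^ c₁ with hK₁_def
  have hK₁0 : 0 ≤ K₁ := div_nonneg hC₁.le hBℓc.le
  -- the ADC window at scale `ℓ = L^{1/4}`: `ℓ ξ(β)⁻¹ ≤ 1` (Fekete and the sphere sum at radius `⌊16L⌋`)
  have hWℓ : β = criticalBeta 4 ∨ (0 < β ∧ ℓ * invCorrLength (twoPointPlus 4 β) ≤ 1) :=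
    Or.inr ⟨hβpos, quarterScale_mul_invCorrLength_le_one hβ hL33 hy_def hy32 hℓ2 hℓ4 hlogℓ (hsph _ le_rfl)⟩
  have hIT : ∀ x : Fin 4 → Site 4, (∀ i j, i ≠ j → n < Site.supNorm (x i - x j)) →
      |connectedFour μ spinAt x| ≤ K₁ * ∑' u, ∏ i, S (x i - u) := by
    intro x hx
    have hdist : ∀ i j, i ≠ j → ℓ < ‖x i - x j‖ := by
      intro i j hij
      rw [Site.norm_eq_supNorm]
      have h1 : (n : ℝ) + 1 ≤ Site.supNorm (x i - x j) := by exact_mod_cast hx i j hij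
      linarith
    have h := H13 β ℓ hβ hβc hℓpos hWℓ μ hμ x hdist
    rw [htp0] at h
    simp only [htp] at h
    exact h (hsumx x)
  -- the split
  have hsplit := sum_abs_le_of_split hS0 hS1 h4 (U := fun x => connectedFour μ spinAt x)
    (latticeBox 4 t) n hK₁0 hTB hIT hW3s
  have hboxn : (#(box 4 n) : ℝ) ≤ 81 * L := by
    have h1 : box 4 n = latticeBox 4 ℓ := (latticeBox_eq_box hℓ0).symm
    rw [h1]
    calc (#(latticeBox 4 ℓ) : ℝ) ≤ (3 * ℓ) ^ 4 := card_latticeBox_le hℓ1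
      _ = 81 * L := by rw [mul_pow, hℓ4]; norm_num
  have hnum : ∑ x ∈ Fintype.piFinset (fun _ : Fin 4 => latticeBox 4 t), |connectedFour μ spinAt x| ≤
      K₁ * (K₄ * D ^ 4 * r ^ 12 * L ^ 4 * boxSusceptibility S L ^ 4) +
        32 * (81 * L) * (K₃ * D ^ 3 * r ^ 10 * L ^ 4 * boxSusceptibility S L ^ 3) :=
    hsplit.trans (add_le_add (mul_le_mul_of_nonneg_left hW4' hK₁0)
      (mul_le_mul (mul_le_mul_of_nonneg_left hboxn (by norm_num)) hW3' hW3_0 (by positivity)))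
  -- lower bound on `Σ_L`
  have hSig : L ^ 4 * boxSusceptibility S L ≤ 256 * D * blockSpinVariance μ L :=
    pow_four_mul_boxSusceptibility_le_blockSpinVariance μ hS hS0 hD h56' hL4
  have hSig' : L ^ 4 * boxSusceptibility S L / (256 * D) ≤ blockSpinVariance μ L := by
    rw [div_le_iff₀ (by positivity)]; linarith
  have hden : (L ^ 4 * boxSusceptibility S L / (256 * D)) ^ 2 ≤ blockSpinVariance μ L ^ 2 :=
    pow_le_pow_left₀ (by positivity) hSig' 2
  have hden0 : 0 < (L ^ 4 * boxSusceptibility S L / (256 * D)) ^ 2 := by positivity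
  have hratio : ursellFourSum μ L r ≤ (K₁ * (K₄ * D ^ 4 * r ^ 12 * L ^ 4 * boxSusceptibility S L ^ 4) +
      32 * (81 * L) * (K₃ * D ^ 3 * r ^ 10 * L ^ 4 * boxSusceptibility S L ^ 3)) /
        (L ^ 4 * boxSusceptibility S L / (256 * D)) ^ 2 := by
    rw [ursellFourSum]
    exact (div_le_div_of_nonneg_left hnum0 hden0 hden).trans (div_le_div_of_nonneg_right hnum hden0.le)
  have hsimp : (K₁ * (K₄ * D ^ 4 * r ^ 12 * L ^ 4 * boxSusceptibility S L ^ 4) +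
      32 * (81 * L) * (K₃ * D ^ 3 * r ^ 10 * L ^ 4 * boxSusceptibility S L ^ 3)) /
        (L ^ 4 * boxSusceptibility S L / (256 * D)) ^ 2 =
      (256 * D) ^ 2 * C₁ * K₄ * D ^ 4 * r ^ 12 * ((boxSusceptibility S L ^ 2 / L ^ 4) / Bℓ ^ c₁) +
      (256 * D) ^ 2 * 2592 * K₃ * D ^ 3 * r ^ 10 * (boxSusceptibility S L / L ^ 3) := by
    rw [hK₁_def]
    field_simp
    ring
  -- ### the logarithmic gain
  have hτ : boxSusceptibility S L ^ 2 / L ^ 4 ≤ T₀ := by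
    rw [hT₀_def, div_le_iff₀ (by positivity)]
    calc boxSusceptibility S L ^ 2 ≤ (Cχ' * L ^ 2) ^ 2 := pow_le_pow_left₀ hχL0 hχLle 2
      _ = Cχ' ^ 2 * L ^ 4 := by ring
  -- the scale `L' = L / log L`
  set L' : ℝ := L / y with hL'_def
  have hL'2 : 2 ≤ L' := by
    rw [hL'_def, le_div_iff₀ hy0]
    -- `log L ≤ L / 2`
    have h1 : Real.log (L / 2) ≤ L / 2 - 1 := Real.log_le_sub_one_of_pos (by positivity)
    have h2 : Real.log 2 ≤ 2 - 1 := Real.log_le_sub_one_of_pos two_pos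
    have h3 : Real.log L = Real.log (L / 2) + Real.log 2 := by
      rw [Real.log_div hLne two_ne_zero]; ring
    rw [hy_def] at h3
    linarith
  have hL'0 : 0 ≤ L' := by linarith
  have hL'1 : 1 ≤ L' := by linarith
  have hL'pos : 0 < L' := by linarith
  have hL'L : L' ≤ L := by rw [hL'_def]; exact div_le_self hL0.le hy1
  set n' : ℕ := ⌊L'⌋₊ with hn'_def
  have hn'2 : 2 ≤ n' := Nat.le_floor (by exact_mod_cast hL'2)
  have hn'le : (n' : ℝ) ≤ L' := Nat.floor_le hL'0
  have hn'gt : L' < (n' : ℝ) + 1 := Nat.lt_floor_add_one L'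
  have hn'2r : (2 : ℝ) ≤ n' := by exact_mod_cast hn'2
  have hn'pos : (0 : ℝ) < n' := by linarith
  have hn'ge : L / (2 * y) ≤ n' := by
    have h1 : L / (2 * y) = L' / 2 := by rw [hL'_def]; field_simp
    rw [h1]; linarith
  have hn'N : n' ≤ N := Nat.floor_le_floor hL'L
  have hNpos : (0 : ℝ) < N := lt_of_lt_of_le hn'pos (by exact_mod_cast hn'N)
  have hBN : bubbleDiagram S (N : ℝ) = bubbleDiagram S L := by
    simp only [bubbleDiagram, latticeBox_natCast, latticeBox_eq_box hL0.le, hN_def]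
  have hBL'1 : 1 ≤ bubbleDiagram S L' := one_le_bubbleDiagram hSz hL'0
  have hBLL' : bubbleDiagram S L' ≤ bubbleDiagram S L := bubbleDiagram_mono S hL'L
  have hBn' : bubbleDiagram S (n' : ℝ) ≤ bubbleDiagram S L' := bubbleDiagram_mono S hn'le
  have hBn'0 : 0 ≤ bubbleDiagram S (n' : ℝ) := bubbleDiagram_nonneg S _
  -- Lemma 6.3 between `n'` and `N`
  have hgrowth : bubbleDiagram S L - bubbleDiagram S L' ≤
      2 * C₂ * (2 + Real.log y) / y * bubbleDiagram S L' := by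
    have h := H63 β n' N hββ₀.le hβc hn'2 hn'N hsphN μ hμ
    rw [htp0, hBN] at h
    -- the factor
    have hlogn' : y / 2 ≤ Real.log n' := by
      have h1 : Real.log (L / (2 * y)) ≤ Real.log n' := Real.log_le_log (by positivity) hn'ge
      have h2 : Real.log (L / (2 * y)) = Real.log L - Real.log (2 * y) :=
        Real.log_div hLne (by positivity)
      rw [hy_def] at h2
      have h3 := log_two_mul_le_half hy32
      linarith
    have hlogn'pos : 0 < Real.log n' := by linarith
    have hquot : (N : ℝ) / n' ≤ 2 * y := by
      rw [div_le_iff₀ hn'pos]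
      calc (N : ℝ) ≤ L := hNL
        _ = 2 * y * (L / (2 * y)) := by field_simp
        _ ≤ 2 * y * n' := by gcongr
    have hquot1 : 1 ≤ (N : ℝ) / n' := by
      rw [le_div_iff₀ hn'pos, one_mul]; exact_mod_cast hn'N
    have hlogquot : Real.log ((N : ℝ) / n') ≤ 1 + Real.log y := by
      have h1 : Real.log ((N : ℝ) / n') ≤ Real.log (2 * y) := Real.log_le_log (by positivity) hquot
      have h2 : Real.log (2 * y) = Real.log 2 + Real.log y := Real.log_mul two_ne_zero hy0.ne'
      have h3 : Real.log 2 ≤ 2 - 1 := Real.log_le_sub_one_of_pos two_pos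
      linarith
    have hlogquot0 : 0 ≤ Real.log ((N : ℝ) / n') := Real.log_nonneg hquot1
    have hlogy0 : 0 ≤ Real.log y := Real.log_nonneg hy1
    have hκ : C₂ * (1 + Real.log ((N : ℝ) / n')) / Real.log n' ≤ 2 * C₂ * (2 + Real.log y) / y := by
      rw [div_le_div_iff₀ hlogn'pos hy0]
      calc C₂ * (1 + Real.log ((N : ℝ) / n')) * y ≤ C₂ * (2 + Real.log y) * y :=
            mul_le_mul_of_nonneg_right (mul_le_mul_of_nonneg_left (by linarith) hC₂.le) hy0.le
        _ = 2 * C₂ * (2 + Real.log y) * (y / 2) := by ring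
        _ ≤ 2 * C₂ * (2 + Real.log y) * Real.log n' :=
            mul_le_mul_of_nonneg_left hlogn' (mul_nonneg (by positivity) (by linarith))
    have hκ0 : 0 ≤ C₂ * (1 + Real.log ((N : ℝ) / n')) / Real.log n' :=
      div_nonneg (mul_nonneg hC₂.le (by linarith)) hlogn'pos.le
    have hBL'0 : 0 ≤ bubbleDiagram S L' := le_trans zero_le_one hBL'1
    calc bubbleDiagram S L - bubbleDiagram S L'
        ≤ (1 + C₂ * (1 + Real.log ((N : ℝ) / n')) / Real.log n') * bubbleDiagram S (n' : ℝ) -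
            bubbleDiagram S L' := by linarith
      _ ≤ (1 + C₂ * (1 + Real.log ((N : ℝ) / n')) / Real.log n') * bubbleDiagram S L' -
            bubbleDiagram S L' :=
          sub_le_sub_right (mul_le_mul_of_nonneg_left hBn' (by linarith)) _
      _ = (C₂ * (1 + Real.log ((N : ℝ) / n')) / Real.log n') * bubbleDiagram S L' := by ring
      _ ≤ 2 * C₂ * (2 + Real.log y) / y * bubbleDiagram S L' := mul_le_mul_of_nonneg_right hκ hBL'0
  -- Lemma 6.3 between `n` and `N`: `B_L ≤ C₅ B_ℓ`
  have hC₅B : bubbleDiagram S L ≤ C₅ * Bℓ := by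
    have h := H63 β n N hββ₀.le hβc hn2 hnN hsphN μ hμ
    rw [htp0, hBN] at h
    have hBn : bubbleDiagram S (n : ℝ) ≤ Bℓ := bubbleDiagram_mono S hnℓ
    have hBn0 : 0 ≤ bubbleDiagram S (n : ℝ) := bubbleDiagram_nonneg S _
    have hlogn : y / 8 ≤ Real.log n := by
      have hnge : ℓ / 2 ≤ n := by linarith
      have h1 : Real.log (ℓ / 2) ≤ Real.log n := Real.log_le_log (by positivity) hnge
      have h2 : Real.log (ℓ / 2) = Real.log ℓ - Real.log 2 := Real.log_div hℓpos.ne' two_ne_zero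
      have h3 : Real.log 2 ≤ 2 - 1 := Real.log_le_sub_one_of_pos two_pos
      rw [hlogℓ] at h2
      linarith
    have hlognpos : 0 < Real.log n := by linarith
    have hquot : (N : ℝ) / n ≤ L := by
      calc (N : ℝ) / n ≤ N := div_le_self (Nat.cast_nonneg N) (by exact_mod_cast (by omega : 1 ≤ n))
        _ ≤ L := hNL
    have hquot1 : 1 ≤ (N : ℝ) / n := by
      rw [le_div_iff₀ hnpos, one_mul]; exact_mod_cast hnN
    have hlogquot : Real.log ((N : ℝ) / n) ≤ y := by
      rw [← hy_def]; exact Real.log_le_log (by positivity) hquot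
    have hlogquot0 : 0 ≤ Real.log ((N : ℝ) / n) := Real.log_nonneg hquot1
    have hκ : C₂ * (1 + Real.log ((N : ℝ) / n)) / Real.log n ≤ 16 * C₂ := by
      rw [div_le_iff₀ hlognpos]
      calc C₂ * (1 + Real.log ((N : ℝ) / n)) ≤ C₂ * (1 + y) :=
            mul_le_mul_of_nonneg_left (by linarith) hC₂.le
        _ ≤ C₂ * (16 * (y / 8)) := mul_le_mul_of_nonneg_left (by linarith) hC₂.le
        _ = 16 * C₂ * (y / 8) := by ring
        _ ≤ 16 * C₂ * Real.log n := mul_le_mul_of_nonneg_left hlogn (by positivity)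
    calc bubbleDiagram S L ≤ (1 + C₂ * (1 + Real.log ((N : ℝ) / n)) / Real.log n) * bubbleDiagram S (n : ℝ) := h
      _ ≤ (1 + 16 * C₂) * Bℓ := mul_le_mul (by linarith) hBn hBn0 (by positivity)
      _ = C₅ * Bℓ := by rw [hC₅_def]
  -- the Cauchy–Schwarz input
  have hCS : boxSusceptibility S L ^ 2 ≤ 2 * boxSusceptibility S L' ^ 2 +
      2 * (3 * L) ^ 4 * (bubbleDiagram S L - bubbleDiagram S L') := by
    have h := sq_boxSusceptibility_le S hL'L
    have hcardL : (#(latticeBox 4 L) : ℝ) ≤ (3 * L) ^ 4 := card_latticeBox_le hL1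
    have hdiff : 0 ≤ bubbleDiagram S L - bubbleDiagram S L' := by linarith
    have h2 : 2 * (#(latticeBox 4 L) : ℝ) * (bubbleDiagram S L - bubbleDiagram S L') ≤
        2 * (3 * L) ^ 4 * (bubbleDiagram S L - bubbleDiagram S L') :=
      mul_le_mul_of_nonneg_right (mul_le_mul_of_nonneg_left hcardL (by norm_num)) hdiff
    linarith
  have hgain : boxSusceptibility S L ^ 2 / (L ^ 4 * Bℓ) ≤ K₈ / Real.sqrt y := by
    rw [hK₈_def, hT₀_def]
    exact sq_div_le_of_log_gain hL hy32 hC₂.le hC₅ (boxSusceptibility_nonneg hS0 L') (hχS L' hL'1)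
      hCS hBL'1 hBLL' hgrowth hBℓ0 hC₅B
  -- exponent bookkeeping
  have hτB : boxSusceptibility S L ^ 2 / L ^ 4 / Bℓ ≤ K₈ / Real.sqrt y := by rw [div_div]; exact hgain
  have h_exp : boxSusceptibility S L ^ 2 / L ^ 4 / Bℓ ^ c₁ ≤ boxSusceptibility S L ^ 2 / L ^ 4 / Bℓ ^ c' :=
    div_le_div_of_nonneg_left (by positivity) (Real.rpow_pos_of_pos hBℓ0 _)
      (Real.rpow_le_rpow_of_exponent_le hBℓ1 hc'c₁)
  have h_split2 : boxSusceptibility S L ^ 2 / L ^ 4 / Bℓ ^ c' ≤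
      T₀ ^ (1 - c') * (boxSusceptibility S L ^ 2 / L ^ 4 / Bℓ) ^ c' :=
    div_rpow_le_rpow_mul_div_rpow (by positivity) hτ hBℓ0 hc' hc'1
  have h_mono : (boxSusceptibility S L ^ 2 / L ^ 4 / Bℓ) ^ c' ≤ (K₈ / Real.sqrt y) ^ c' :=
    Real.rpow_le_rpow (by positivity) hτB hc'.le
  have h_eval : (K₈ / Real.sqrt y) ^ c' = K₈ ^ c' / y ^ c := by
    rw [Real.div_rpow hK₈ (Real.sqrt_nonneg _), Real.sqrt_eq_rpow, ← Real.rpow_mul hy0.le, hc_def]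
    congr 1
    ring_nf
  have hyc : y ^ c ≤ L := hlogcL
  have hycpos : 0 < y ^ c := hlogc0
  have hfirst : boxSusceptibility S L ^ 2 / L ^ 4 / Bℓ ^ c₁ ≤ T₀ ^ (1 - c') * K₈ ^ c' / y ^ c := by
    calc boxSusceptibility S L ^ 2 / L ^ 4 / Bℓ ^ c₁ ≤ boxSusceptibility S L ^ 2 / L ^ 4 / Bℓ ^ c' := h_exp
      _ ≤ T₀ ^ (1 - c') * (boxSusceptibility S L ^ 2 / L ^ 4 / Bℓ) ^ c' := h_split2
      _ ≤ T₀ ^ (1 - c') * (K₈ / Real.sqrt y) ^ c' :=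
          mul_le_mul_of_nonneg_left h_mono (Real.rpow_nonneg (by positivity) _)
      _ = T₀ ^ (1 - c') * K₈ ^ c' / y ^ c := by rw [h_eval, mul_div_assoc]
  have hsecond : r ^ 10 * (boxSusceptibility S L / L ^ 3) ≤ r ^ 12 * (Cχ' / y ^ c) := by
    have h1 : r ^ 10 ≤ r ^ 12 := pow_le_pow_right₀ hr (by norm_num)
    have h2 : boxSusceptibility S L / L ^ 3 ≤ Cχ' / y ^ c := by
      calc boxSusceptibility S L / L ^ 3 ≤ Cχ' * L ^ 2 / L ^ 3 := by gcongr
        _ = Cχ' / L := by field_simp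
        _ ≤ Cχ' / y ^ c := div_le_div_of_nonneg_left hCχ' hycpos hyc
    exact mul_le_mul h1 h2 (by positivity) (by positivity)
  -- ### conclusion of Regime B
  calc ursellFourSum μ L r
      ≤ (256 * D) ^ 2 * C₁ * K₄ * D ^ 4 * r ^ 12 * ((boxSusceptibility S L ^ 2 / L ^ 4) / Bℓ ^ c₁) +
          (256 * D) ^ 2 * 2592 * K₃ * D ^ 3 * r ^ 10 * (boxSusceptibility S L / L ^ 3) := by
        rw [← hsimp]; exact hratio
    _ = (256 * D) ^ 2 * C₁ * K₄ * D ^ 4 * r ^ 12 * ((boxSusceptibility S L ^ 2 / L ^ 4) / Bℓ ^ c₁) +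
          (256 * D) ^ 2 * 2592 * K₃ * D ^ 3 * (r ^ 10 * (boxSusceptibility S L / L ^ 3)) := by ring
    _ ≤ (256 * D) ^ 2 * C₁ * K₄ * D ^ 4 * r ^ 12 * (T₀ ^ (1 - c') * K₈ ^ c' / y ^ c) +
          (256 * D) ^ 2 * 2592 * K₃ * D ^ 3 * (r ^ 12 * (Cχ' / y ^ c)) :=
        add_le_add (mul_le_mul_of_nonneg_left hfirst (by positivity))
          (mul_le_mul_of_nonneg_left hsecond (by positivity))
    _ = (K_B1 + K_B2) * (r ^ 12 / y ^ c) := by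
        rw [hK_B1_def, hK_B2_def]
        field_simp
    _ ≤ C * (r ^ 12 / y ^ c) := mul_le_mul_of_nonneg_right hC_B (by positivity)
    _ = C * r ^ 12 / y ^ c := by rw [mul_div_assoc]

end Assembly

end Literature.Probability.LatticeModels
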